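import Summits.CriticalPhenomena.PercolationContinuityZ3.Theorems.PercNearOneGluingAdditiveGluingClusterCovTransfer
import Mathlib.Tactic.Linarith
import HarnessLib

/-!
# `NoHeavyLowerTail` (stmt-CriticalPhenomena-4575) — merging a vertex into the apex: the one-set BHK row, merge-monotonicity
# and the κ-inequality of the apex-edge mixture (gen 33)

Support file (prover seat `prim-ineq-gen-8`, gen 33; `--supports stmt-CriticalPhenomena-4575`; memo
`run/shared/lean/prim/prim-ineq-gen-8/FINDING-gen33-MIXTURE.md` §5).  No definitions, no named facts, no sorries.

CONTEXT.  Gen 33 writes the four-point step of the apex-pair programme as a cell MIXTURE along an apex edge `y–x`: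
`cells(G) = (1−p)·cells(T_y) + p·cells(T_m)`, `T_y = (y; b,c)` in `G' = G − e`, `T_m = ({x,y}; b,c)` (x merged into the apex).
In the isolation coordinates `I = (u0, isoA, isoB, isoC)` — for apex `y`: `u0 = μ(y↮b, y↮c, b↮c)`, `isoB = μ(b↮y, b↮c)`,
`isoC = μ(c↮y, c↮b)` — merging `x` into `y` multiplies `I` coordinatewise by `S = I_m ⊘ I_y`, and the reduction theorem of memo §5
needs, besides the tree envelope itself, two sign conditions on `S`:
 (R0) merge-monotonicity `isoC_m/isoC_y ≥ u0_m/u0_y` (and `b ↔ c`), and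
 (R2) the κ-inequality `isoB_m/isoB_y + isoC_m/isoC_y ≥ 1 + u0_m/u0_y` (equality for independent pieces).
Both follow from ONE instance of van den Berg–Häggström–Kahn 2006, Thm. 2.1 (sets, `q = 1`), PROVED in the tree as
`Literature.Probability.Percolation.setTwoClusterExchange`: with `S = {b}`, `T = {y, c}`, `f = 1{b ↔ x}` (increasing in `C_S`),
`g = 1{y ↔ c}` (increasing in `C_T`): on `{b ↮ y, b ↮ c}` the events `{x ↔ b}` and `{y ↔ c}` are negatively correlated, i.e.
"given that `b`'s cluster avoids `y` and `c`, learning `y ↮ c` makes `x ∈ C_b` more likely".  (Reused: `ClusterCovTransfer.real_eq_inter_add_inter_compl`, `KNPreFKG.openConn_symm`.)  This file derives: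
* `APL.merge_oneSet_negCorrelation` — `μ(Q)·μ(Q ∩ {b↔x} ∩ {y↔c}) ≤ μ(Q ∩ {b↔x})·μ(Q ∩ {y↔c})`, `Q = {b↮y} ∩ {b↮c}`;
* `APL.merge_attach_mono` — the complement form `μ(Q ∩ {b↔x})·μ(Q ∩ {y↮c}) ≤ μ(Q ∩ {b↔x} ∩ {y↮c})·μ(Q)`
  (`P(x↔b | b∤{y,c}, y↮c) ≥ P(x↔b | b∤{y,c})`);
* `APL.merge_iso_mono` — (R0) cleared of denominators: `μ(u0_m-event)·μ(isoC_y-event) ≤ μ(isoC_m-event)·μ(u0_y-event)`;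
* `APL.merge_kappa_nonneg` — (R2) cleared of denominators:
  `μ(IB)μ(IC)μ(U) + μ(U ∩ {x↮b} ∩ {x↮c})μ(IB)μ(IC) ≤ μ(IB ∩ {x↮b})μ(IC)μ(U) + μ(IC ∩ {x↮c})μ(IB)μ(U)`
  with `IB = {b↮y}∩{b↮c}`, `IC = {c↮y}∩{c↮b}`, `U = IB ∩ {y↮c}` = "y, b, c pairwise separated".  [this work]
-/

noncomputable section

open MeasureTheory Set
open Literature.Probability.LatticeModels (prodBernoulli)
open Literature.Probability.Percolation Literature.Probability.Percolation.TwoSetExchange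
open Literature.Probability.Percolation.KNPreFKG (openConn_symm)

namespace Summit.CriticalPhenomena.PercolationContinuityZ3.Theorems

namespace APL

variable {V : Type*} [Fintype V]

omit [Fintype V] in
/-- The one-set separation event `{{b} ↮ {y,c}}` written with `openConn`: `{b↮y} ∩ {b↮c}`. [folklore] -/
theorem setOf_single_notReachable_pair_eq (b y c : V) :
    {ω : BondConfig V | ∀ s ∈ ({b} : Set V), ∀ t ∈ ({y, c} : Set V), ¬ (openGraph ω).Reachable s t} =
      ((openConn b y)ᶜ ∩ (openConn b c)ᶜ : Set (BondConfig V)) := by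
  ext ω
  simp only [mem_setOf_eq, mem_insert_iff, mem_singleton_iff, forall_eq_or_imp, forall_eq, mem_inter_iff,
    mem_compl_iff, openConn]

/-- **BHK 2006 Thm. 2.1 (sets), the instance `S = {b}`, `T = {y,c}`, `f = 1{b↔x}`, `g = 1{y↔c}`:**
with `Q = {b↮y} ∩ {b↮c}`, `μ(Q) · μ(Q ∩ ({b↔x} ∩ {y↔c})) ≤ μ(Q ∩ {b↔x}) · μ(Q ∩ {y↔c})`
(`Cov(1{x ∈ C_b}, 1{y↔c} | b ∤ {y,c}) ≤ 0`).  Proof: `setTwoClusterExchange` with `A₁ = B₁ = univ`, `A₂ = {b↔x}`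
(closed under enlarging `C_S`), `B₂ = {y↔c}` (closed under enlarging `C_T`).
[cite: VandenbergHaggstromKahn2005, Thm. 2.1 (p. 9) at q = 1 — corollary, derived in this file] -/
theorem merge_oneSet_negCorrelation (w : Sym2 V → unitInterval) (x y b c : V) :
    (prodBernoulli w).real ((openConn b y)ᶜ ∩ (openConn b c)ᶜ : Set (BondConfig V)) *
      (prodBernoulli w).real (((openConn b y)ᶜ ∩ (openConn b c)ᶜ) ∩
          ((openConn b x : Set (BondConfig V)) ∩ openConn y c)) ≤
    (prodBernoulli w).real (((openConn b y)ᶜ ∩ (openConn b c)ᶜ) ∩ (openConn b x : Set (BondConfig V))) *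
      (prodBernoulli w).real (((openConn b y)ᶜ ∩ (openConn b c)ᶜ) ∩ (openConn y c : Set (BondConfig V))) := by
  have hb : b ∈ ({b} : Set V) := mem_singleton b
  have hy : y ∈ ({y, c} : Set V) := mem_insert y {c}
  have key := setTwoClusterExchange w ({b} : Set V) ({y, c} : Set V)
    (A₁ := (univ : Set (BondConfig V))) (A₂ := (openConn b x : Set (BondConfig V)))
    (B₁ := (univ : Set (BondConfig V))) (B₂ := (openConn y c : Set (BondConfig V)))
    (fun _ _ _ _ _ => mem_univ _)
    (fun _ _ hs ht h => typePlus_openConn_of_mem ({b} : Set V) ({y, c} : Set V) hb x hs ht h)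
    (fun _ _ _ _ _ => mem_univ _)
    (fun _ _ hs ht h => typeMinus_openConn_of_mem ({b} : Set V) ({y, c} : Set V) hy c hs ht h)
  rw [setOf_single_notReachable_pair_eq] at key
  simpa only [univ_inter, inter_univ] using key

/-- **Merge-attachment monotonicity (complement form of the BHK instance).**  With `Q = {b↮y} ∩ {b↮c}`:
`μ(Q ∩ {b↔x}) · μ(Q ∩ {y↮c}) ≤ μ(Q ∩ ({b↔x} ∩ {y↮c})) · μ(Q)`, i.e. `P(x ∈ C_b | b ∤ {y,c}, y ↮ c) ≥ P(x ∈ C_b | b ∤ {y,c})`: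
conditioning additionally on `y ↮ c` can only help `x` to lie in `b`'s cluster (the `x`-vertices of `C_b` are unavailable to
`y–c` paths).  [this work] -/
theorem merge_attach_mono (w : Sym2 V → unitInterval) (x y b c : V) :
    (prodBernoulli w).real (((openConn b y)ᶜ ∩ (openConn b c)ᶜ) ∩ (openConn b x : Set (BondConfig V))) *
      (prodBernoulli w).real (((openConn b y)ᶜ ∩ (openConn b c)ᶜ) ∩ (openConn y c : Set (BondConfig V))ᶜ) ≤
    (prodBernoulli w).real (((openConn b y)ᶜ ∩ (openConn b c)ᶜ) ∩
        ((openConn b x : Set (BondConfig V)) ∩ (openConn y c : Set (BondConfig V))ᶜ)) *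
      (prodBernoulli w).real ((openConn b y)ᶜ ∩ (openConn b c)ᶜ : Set (BondConfig V)) := by
  set μ := prodBernoulli w with hμ
  set Q : Set (BondConfig V) := ((openConn b y)ᶜ ∩ (openConn b c)ᶜ : Set (BondConfig V)) with hQ
  set A : Set (BondConfig V) := (openConn b x : Set (BondConfig V)) with hA
  set B : Set (BondConfig V) := (openConn y c : Set (BondConfig V)) with hB
  have key : μ.real Q * μ.real (Q ∩ (A ∩ B)) ≤ μ.real (Q ∩ A) * μ.real (Q ∩ B) :=
    merge_oneSet_negCorrelation w x y b c
  have s1 : μ.real (Q ∩ A) = μ.real (Q ∩ (A ∩ B)) + μ.real (Q ∩ (A ∩ Bᶜ)) := by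
    rw [← inter_assoc Q A B, ← inter_assoc Q A Bᶜ]; exact ClusterCovTransfer.real_eq_inter_add_inter_compl w (Q ∩ A) B
  have s2 : μ.real Q = μ.real (Q ∩ B) + μ.real (Q ∩ Bᶜ) := ClusterCovTransfer.real_eq_inter_add_inter_compl w Q B
  change μ.real (Q ∩ A) * μ.real (Q ∩ Bᶜ) ≤ μ.real (Q ∩ (A ∩ Bᶜ)) * μ.real Q
  rw [show μ.real (Q ∩ Bᶜ) = μ.real Q - μ.real (Q ∩ B) by linarith,
    show μ.real (Q ∩ (A ∩ Bᶜ)) = μ.real (Q ∩ A) - μ.real (Q ∩ (A ∩ B)) by linarith]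
  nlinarith [key]

omit [Fintype V] in
/-- On `{b↮c}` the events `{b↔x}` and `{c↔x}` are disjoint: `{b↮c} ∩ {b↔x} ∩ {c↔x} = ∅`. [folklore] -/
theorem notConn_inter_conn_inter_conn_eq_empty (x b c : V) :
    ((openConn b c)ᶜ ∩ (openConn b x : Set (BondConfig V)) ∩ (openConn c x : Set (BondConfig V))) = ∅ := by
  ext ω
  refine ⟨fun h => ?_, fun h => False.elim h⟩
  obtain ⟨⟨hbc, hbx⟩, hcx⟩ := h
  exact hbc (show (openGraph ω).Reachable b c from
    SimpleGraph.Reachable.trans hbx (SimpleGraph.Reachable.symm hcx))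

/-- **(R0) merge-monotonicity of the isolation ratio.**  With `IC = {c↮y} ∩ {c↮b}` (the `isoC` event of apex `y`) and
`U = {b↮y} ∩ {b↮c} ∩ {y↮c}` (the `u0` event: `y, b, c` pairwise separated):
`μ(U ∩ {b↮x} ∩ {c↮x}) · μ(IC) ≤ μ(IC ∩ {c↮x}) · μ(U)`, i.e. `u0_m/u0_y ≤ isoC_m/isoC_y` — merging `x` into the apex
never decreases the coordinate `X = log(isoC/u0)` (memo §5, R0). [this work] -/
theorem merge_iso_mono (w : Sym2 V → unitInterval) (x y b c : V) :
    (prodBernoulli w).real ((((openConn b y)ᶜ ∩ (openConn b c)ᶜ ∩ (openConn y c)ᶜ) ∩ (openConn b x)ᶜ ∩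
        (openConn c x)ᶜ : Set (BondConfig V))) *
      (prodBernoulli w).real ((openConn c y)ᶜ ∩ (openConn c b)ᶜ : Set (BondConfig V)) ≤
    (prodBernoulli w).real (((openConn c y)ᶜ ∩ (openConn c b)ᶜ) ∩ (openConn c x : Set (BondConfig V))ᶜ) *
      (prodBernoulli w).real ((openConn b y)ᶜ ∩ (openConn b c)ᶜ ∩ (openConn y c)ᶜ : Set (BondConfig V)) := by
  set μ := prodBernoulli w with hμ
  -- the c-side BHK monotonicity: S = {c}, T = {y, b}
  have monoC := merge_attach_mono w x y c b
  set IC : Set (BondConfig V) := ((openConn c y)ᶜ ∩ (openConn c b)ᶜ : Set (BondConfig V)) with hIC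
  set U : Set (BondConfig V) := ((openConn b y)ᶜ ∩ (openConn b c)ᶜ ∩ (openConn y c)ᶜ : Set (BondConfig V)) with hU
  set Cx : Set (BondConfig V) := (openConn c x : Set (BondConfig V)) with hCx
  set Bx : Set (BondConfig V) := (openConn b x : Set (BondConfig V)) with hBx
  -- identify the c-side guard `IC ∩ {y↮b}` with `U`
  have hUc : IC ∩ (openConn y b : Set (BondConfig V))ᶜ = U := by
    rw [hIC, hU, openConn_symm c b, openConn_symm y b, openConn_symm c y]
    ext ω; simp only [mem_inter_iff, mem_compl_iff]; tauto
  have hUCx : IC ∩ (Cx ∩ (openConn y b : Set (BondConfig V))ᶜ) = U ∩ Cx := by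
    rw [← hUc]; ext ω; simp only [mem_inter_iff]; tauto
  change μ.real (IC ∩ Cx) * μ.real (IC ∩ (openConn y b : Set (BondConfig V))ᶜ) ≤
      μ.real (IC ∩ (Cx ∩ (openConn y b : Set (BondConfig V))ᶜ)) * μ.real IC at monoC
  rw [hUc, hUCx] at monoC
  -- splits
  have sC : μ.real IC = μ.real (IC ∩ Cx) + μ.real (IC ∩ Cxᶜ) := ClusterCovTransfer.real_eq_inter_add_inter_compl w IC Cx
  have sU1 : μ.real U = μ.real (U ∩ Bx) + μ.real (U ∩ Bxᶜ) := ClusterCovTransfer.real_eq_inter_add_inter_compl w U Bx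
  have sU2 : μ.real (U ∩ Bxᶜ) = μ.real (U ∩ Bxᶜ ∩ Cx) + μ.real (U ∩ Bxᶜ ∩ Cxᶜ) := ClusterCovTransfer.real_eq_inter_add_inter_compl w (U ∩ Bxᶜ) Cx
  have hdis : U ∩ Bxᶜ ∩ Cx = U ∩ Cx := by
    have he := notConn_inter_conn_inter_conn_eq_empty (V := V) x b c
    ext ω
    simp only [mem_inter_iff, mem_compl_iff]
    constructor
    · rintro ⟨⟨hu, -⟩, hc⟩; exact ⟨hu, hc⟩
    · rintro ⟨hu, hc⟩
      refine ⟨⟨hu, fun hb => ?_⟩, hc⟩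
      have : ω ∈ ((openConn b c)ᶜ ∩ (openConn b x : Set (BondConfig V)) ∩ (openConn c x : Set (BondConfig V))) := by
        rw [hU] at hu
        simp only [mem_inter_iff, mem_compl_iff] at hu ⊢
        exact ⟨⟨hu.1.2, hb⟩, hc⟩
      rw [he] at this
      exact this
  rw [hdis] at sU2
  have h1 : 0 ≤ μ.real (U ∩ Bx) := measureReal_nonneg
  have h3 : 0 ≤ μ.real IC := measureReal_nonneg
  change μ.real (U ∩ Bxᶜ ∩ Cxᶜ) * μ.real IC ≤ μ.real (IC ∩ Cxᶜ) * μ.real U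
  rw [show μ.real (U ∩ Bxᶜ ∩ Cxᶜ) = μ.real U - μ.real (U ∩ Bx) - μ.real (U ∩ Cx) by linarith,
    show μ.real (IC ∩ Cxᶜ) = μ.real IC - μ.real (IC ∩ Cx) by linarith]
  nlinarith [monoC, mul_nonneg h1 h3]

/-- **(R2) the κ-inequality of the merge increment.**  With `IB = {b↮y} ∩ {b↮c}` (`isoB` of apex `y`), `IC = {c↮y} ∩ {c↮b}`
(`isoC`), `U = {b↮y} ∩ {b↮c} ∩ {y↮c}` (`u0`: `y, b, c` pairwise separated), and the merged-apex events
`IB ∩ {b↮x}` (`isoB_m`), `IC ∩ {c↮x}` (`isoC_m`), `U ∩ {b↮x} ∩ {c↮x}` (`u0_m`):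
`μ(IB)·μ(IC)·μ(U) + μ(U ∩ {b↮x} ∩ {c↮x})·μ(IB)·μ(IC) ≤ μ(IB ∩ {b↮x})·μ(IC)·μ(U) + μ(IC ∩ {c↮x})·μ(IB)·μ(U)`,
i.e. (dividing by `μ(IB)μ(IC)μ(U) > 0`)  **`isoB_m/isoB_y + isoC_m/isoC_y ≥ 1 + u0_m/u0_y`** — `κ_S ≥ 0` in memo §5, with
equality when `x` and `y` lie in independent pieces.  Proof: the difference is
`μ(IC)·[μ(U∩{b↔x})μ(IB) − μ(IB∩{b↔x})μ(U)] + μ(IB)·[μ(U∩{c↔x})μ(IC) − μ(IC∩{c↔x})μ(U)]`, two instances of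
`merge_attach_mono`. [this work] -/
theorem merge_kappa_nonneg (w : Sym2 V → unitInterval) (x y b c : V) :
    (prodBernoulli w).real ((openConn b y)ᶜ ∩ (openConn b c)ᶜ : Set (BondConfig V)) *
        (prodBernoulli w).real ((openConn c y)ᶜ ∩ (openConn c b)ᶜ : Set (BondConfig V)) *
        (prodBernoulli w).real ((openConn b y)ᶜ ∩ (openConn b c)ᶜ ∩ (openConn y c)ᶜ : Set (BondConfig V)) +
      (prodBernoulli w).real ((((openConn b y)ᶜ ∩ (openConn b c)ᶜ ∩ (openConn y c)ᶜ) ∩ (openConn b x)ᶜ ∩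
          (openConn c x)ᶜ : Set (BondConfig V))) *
        (prodBernoulli w).real ((openConn b y)ᶜ ∩ (openConn b c)ᶜ : Set (BondConfig V)) *
        (prodBernoulli w).real ((openConn c y)ᶜ ∩ (openConn c b)ᶜ : Set (BondConfig V)) ≤
    (prodBernoulli w).real (((openConn b y)ᶜ ∩ (openConn b c)ᶜ) ∩ (openConn b x : Set (BondConfig V))ᶜ) *
        (prodBernoulli w).real ((openConn c y)ᶜ ∩ (openConn c b)ᶜ : Set (BondConfig V)) *
        (prodBernoulli w).real ((openConn b y)ᶜ ∩ (openConn b c)ᶜ ∩ (openConn y c)ᶜ : Set (BondConfig V)) +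
      (prodBernoulli w).real (((openConn c y)ᶜ ∩ (openConn c b)ᶜ) ∩ (openConn c x : Set (BondConfig V))ᶜ) *
        (prodBernoulli w).real ((openConn b y)ᶜ ∩ (openConn b c)ᶜ : Set (BondConfig V)) *
        (prodBernoulli w).real ((openConn b y)ᶜ ∩ (openConn b c)ᶜ ∩ (openConn y c)ᶜ : Set (BondConfig V)) := by
  set μ := prodBernoulli w with hμ
  have monoB := merge_attach_mono w x y b c
  have monoC := merge_attach_mono w x y c b
  set IB : Set (BondConfig V) := ((openConn b y)ᶜ ∩ (openConn b c)ᶜ : Set (BondConfig V)) with hIB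
  set IC : Set (BondConfig V) := ((openConn c y)ᶜ ∩ (openConn c b)ᶜ : Set (BondConfig V)) with hIC
  set U : Set (BondConfig V) := ((openConn b y)ᶜ ∩ (openConn b c)ᶜ ∩ (openConn y c)ᶜ : Set (BondConfig V)) with hU
  set Bx : Set (BondConfig V) := (openConn b x : Set (BondConfig V)) with hBx
  set Cx : Set (BondConfig V) := (openConn c x : Set (BondConfig V)) with hCx
  -- b-side: guard IB ∩ {y↮c} = U
  have hUb : IB ∩ (openConn y c : Set (BondConfig V))ᶜ = U := by
    rw [hIB, hU]
  have hUBx : IB ∩ (Bx ∩ (openConn y c : Set (BondConfig V))ᶜ) = U ∩ Bx := by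
    rw [← hUb]; ext ω; simp only [mem_inter_iff]; tauto
  change μ.real (IB ∩ Bx) * μ.real (IB ∩ (openConn y c : Set (BondConfig V))ᶜ) ≤
      μ.real (IB ∩ (Bx ∩ (openConn y c : Set (BondConfig V))ᶜ)) * μ.real IB at monoB
  rw [hUb, hUBx] at monoB
  -- c-side: guard IC ∩ {y↮b} = U
  have hUc : IC ∩ (openConn y b : Set (BondConfig V))ᶜ = U := by
    rw [hIC, hU, openConn_symm c b, openConn_symm y b, openConn_symm c y]
    ext ω; simp only [mem_inter_iff, mem_compl_iff]; tauto
  have hUCx : IC ∩ (Cx ∩ (openConn y b : Set (BondConfig V))ᶜ) = U ∩ Cx := by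
    rw [← hUc]; ext ω; simp only [mem_inter_iff]; tauto
  change μ.real (IC ∩ Cx) * μ.real (IC ∩ (openConn y b : Set (BondConfig V))ᶜ) ≤
      μ.real (IC ∩ (Cx ∩ (openConn y b : Set (BondConfig V))ᶜ)) * μ.real IC at monoC
  rw [hUc, hUCx] at monoC
  -- splits
  have sB : μ.real IB = μ.real (IB ∩ Bx) + μ.real (IB ∩ Bxᶜ) := ClusterCovTransfer.real_eq_inter_add_inter_compl w IB Bx
  have sC : μ.real IC = μ.real (IC ∩ Cx) + μ.real (IC ∩ Cxᶜ) := ClusterCovTransfer.real_eq_inter_add_inter_compl w IC Cx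
  have sU1 : μ.real U = μ.real (U ∩ Bx) + μ.real (U ∩ Bxᶜ) := ClusterCovTransfer.real_eq_inter_add_inter_compl w U Bx
  have sU2 : μ.real (U ∩ Bxᶜ) = μ.real (U ∩ Bxᶜ ∩ Cx) + μ.real (U ∩ Bxᶜ ∩ Cxᶜ) := ClusterCovTransfer.real_eq_inter_add_inter_compl w (U ∩ Bxᶜ) Cx
  have hdis : U ∩ Bxᶜ ∩ Cx = U ∩ Cx := by
    have he := notConn_inter_conn_inter_conn_eq_empty (V := V) x b c
    ext ω
    simp only [mem_inter_iff, mem_compl_iff]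
    constructor
    · rintro ⟨⟨hu, -⟩, hc⟩; exact ⟨hu, hc⟩
    · rintro ⟨hu, hc⟩
      refine ⟨⟨hu, fun hb => ?_⟩, hc⟩
      have : ω ∈ ((openConn b c)ᶜ ∩ (openConn b x : Set (BondConfig V)) ∩ (openConn c x : Set (BondConfig V))) := by
        rw [hU] at hu
        simp only [mem_inter_iff, mem_compl_iff] at hu ⊢
        exact ⟨⟨hu.1.2, hb⟩, hc⟩
      rw [he] at this
      exact this
  rw [hdis] at sU2
  have hB0 : 0 ≤ μ.real IB := measureReal_nonneg
  have hC0 : 0 ≤ μ.real IC := measureReal_nonneg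
  have eB : 0 ≤ μ.real IC * (μ.real (U ∩ Bx) * μ.real IB - μ.real (IB ∩ Bx) * μ.real U) :=
    mul_nonneg hC0 (by linarith [monoB])
  have eC : 0 ≤ μ.real IB * (μ.real (U ∩ Cx) * μ.real IC - μ.real (IC ∩ Cx) * μ.real U) :=
    mul_nonneg hB0 (by linarith [monoC])
  change μ.real IB * μ.real IC * μ.real U + μ.real (U ∩ Bxᶜ ∩ Cxᶜ) * μ.real IB * μ.real IC ≤
      μ.real (IB ∩ Bxᶜ) * μ.real IC * μ.real U + μ.real (IC ∩ Cxᶜ) * μ.real IB * μ.real U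
  rw [show μ.real (U ∩ Bxᶜ ∩ Cxᶜ) = μ.real U - μ.real (U ∩ Bx) - μ.real (U ∩ Cx) by linarith,
    show μ.real (IB ∩ Bxᶜ) = μ.real IB - μ.real (IB ∩ Bx) by linarith,
    show μ.real (IC ∩ Cxᶜ) = μ.real IC - μ.real (IC ∩ Cx) by linarith]
  nlinarith [eB, eC]

end APL

end Summit.CriticalPhenomena.PercolationContinuityZ3.Theorems

end
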